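import Summits.Ventures.YMGap.YM3IR.BalabanCeilings
import Summits.Ventures.YMGap.RobustBall.TorusRowsSU2StarW3
import HarnessLib

/-!
# YM3IR / BalabanCeilingsSU2W — the §Y4 sentences for `SU(2)` on the TIER-2 (weighted, infinite-range) ball at ds-2's robust-star
W rows (Wilson `β_W = 1/2` at rate `1/100`; `β_W = 9/20` at the lineage rate `log (6/5)`), Y2's input HYPOTHESIS-FREE, with the
counted crossover (theorems only; no new conjecture name)

HONEST FRAMING (cell pub-ymgap, track Y4 / YM3-IR, seat ym3ir-theory-1, gen 10; follow-up to `YM3IR/CovariantFamily.lean`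
(`massGap3Cofinal_su2_W_of_irConjecture3Cov`: the covariant §Y4 sentence on the tier-2 ball, tree ceiling `1/16` = Wilson `β_W = 1/8`, rate
`log (6/5)`) and `YM3IR/BalabanCeilings.lean` §2 (tier-1 robust-star row, Wilson `1/2`), written once ds-2's weighted robust-star door
`RobustBall/RobustStarDoorW.lean` and its `d = 3` rows `RobustBall/TorusRowsSU2StarW3.lean` were in the tree).  This file claims NO summit,
NO mass gap and NO part of Bałaban's theorems.  It is kernel-checked BOOKKEEPING: `BalabanSUN.massGap3Cofinal_suN_balaban_of_irConjecture3`
at `N = 2` with track Y2's input (`ClusterDomainClustering` on the TIER-2 ball `ClusterDomain κ_b (2ε) ε`) DISCHARGED BY NAME and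
HYPOTHESIS-FREE by ds-2's rows `RobustBall.su2_clusterDomainClusteringW_dim3_star_oneHalf_t100 κ_b hκb` (ball `ClusterDomain κ_b (4/125)
(2/125)` for every `κ_b ≥ 1/100`, tree ceiling `1/4` = Wilson `β_W = 1/2`, clustering rate `1/100`) and
`RobustBall.su2_clusterDomainClusteringW_dim3_star_nineTwentieths_w65` (ball `ClusterDomain (log 6/5) (7/250) (7/500)`, tree ceiling `9/40`
= Wilson `9/20`, rate `log (6/5)` — the rate of the tier-2 sentence of `CovariantFamily`) — ds-2's WEIGHTED robust vertex-star door
(Dobrushin–Shlosman window iteration with Georgii's exponential weights, NO finite-range hypothesis) on the quarter modulus, exact-rational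
certificates.  WHY THE TIER-2 BALL IS THE ONE THAT MATTERS for the covariant form: images of gauge-covariant local averaging are expected
to have infinite range at every `β > 0` (the `BalabanCeilings` §2 caveat on `…_star_oneHalf_of_irConjecture3Cov`), so `IRConjecture3Cov` is
read on `ClusterDomain κ ε₀ ε₁`, not on its finite-range sub-ball; there the `SU(2)` receiving ceiling moves from Wilson `1/8` to `1/2`.
Lattice statements only; no continuum limit, no Millennium claim; no axiom, no `sorry`, no `def`; `0` compute.

THE HYPOTHESIS LIST, VERBATIM (`massGap3Cofinal_su2_W_oneHalf_of_irConjecture3Cov`): `BalabanUV3 mk` — IN PRINT (Bałaban, CMP 102 (1985),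
Thm 1 p. 257 + Thm 2 p. 272), logically IDLE in the arrow (theory-2 F2; R196; deleted outright in the `_printFree` form); `Nonempty (Family L
eps0)` — print's clauses at one coupling (p. 256 L15–18); `0 < C_b`, `0 < κ`; `1/100 ≤ κ_b` (the ball parameter); `IRConjecture3Cov
(ballOfRobustBall 2 κ_b (4/125) (2/125) (1/4)) suFrobDist (fundamentalRep (Fin 2)) (balabanCouplings L (suGroupModel 2) eps0) C_b κ` — the
COVARIANT conjecture (theory-1 and theory-2, `YM3IR/CovariantFamily.lean`; NOT in print).  LABELS OF RECORD (R196, verbatim): the free-family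
`IRConjecture3` with existential `(C_b, κ)` is a typed INTERFACE / dictionary, NOT a reduction — target-equivalent on every receiving ball in
the tree, the tier-2 balls included (theory-2, `YM3IR/ForestWitnessSUN.lean`, `forestWitness3_ball`); `IRConjecture3Cov` «⟹ target PROVED;
converse NOT KNOWN; a genuine sufficient condition, possibly strictly stronger, never "the remaining gap"».  CONCLUSION:
`MassGap3Cofinal (balabanCouplings L (suGroupModel 2) eps0) suFrobDist (fundamentalRep (Fin 2))`.

COUNTED CROSSOVER (PROVED arithmetic, tree units `β = β_W/2`; the lemmas are `BalabanCeilings.su2_betaTree_div_pow_le_quarter_iff` /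
`su2_two_le_pow_of_betaTree_div_pow_le_quarter`, unchanged): below the ceiling `1/4` after `K + M'` steps iff `L^{M'} ≥ 2/γ₀²`; since
`γ₀² ≤ 1` this forces `M' ≥ 1` on the weighted ball as well (`su2_row_W_oneHalf_crossover_pos`).

WHY THIS IS USEFUL (one sentence).  It puts the covariant §Y4 sentence — the one whose conjecture is a genuine sufficient condition and
whose natural ball is the weighted one — at the same Wilson ceiling `1/2` as the best hypothesis-free finite-range row, kernel-checked and
by name, and records what that leaves for the crossover.

References: T. Bałaban, CMP 102 (1985) 255–275, p. 256 L15–18, (5) p. 256, Thm 1 p. 257, Thm 2 p. 272 [cite: Balaban1985UV3]; CMP 98 (1985)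
17–51, (11), (15) p. 19 [cite: Balaban1985Averaging] (block locality = a property of the average (15), no numbered display).
-/

noncomputable section

open MeasureTheory
open Literature.MathematicalPhysics.QuantumLattice Literature.MathematicalPhysics.QuantumFieldTheory
open Balaban1985CMP102 Balaban1985CMP102.Setting Balaban1985CMP102.Theorems
open Literature.MathematicalPhysics.QuantumFieldTheory.Balaban1983to89 (GaugeGroup HaarData)
open Summit.QuantumFields.Balaban3D.Carriers (suGroupModel)

namespace Summit.Ventures.YMGap.YM3IR

open CarrierBridge

/-! ## §1  Wilson `β_W = 1/2` on the weighted ball, rate `1/100`, every ball parameter `κ_b ≥ 1/100` -/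

/-- **`SU(2)` lattice YM₃ mass gap on Bałaban's coupling set, receiving on the TIER-2 ball at Wilson `β_W = 1/2`, Y2's input
HYPOTHESIS-FREE (PROVED bookkeeping).**  ds-2's weighted robust-star row `RobustBall.su2_clusterDomainClusteringW_dim3_star_oneHalf_t100 κ_b hκb`
BY NAME (tree ceiling `1/4`, ball `ClusterDomain κ_b (4/125) (2/125)`, rate `1/100`).  The hypothesis that is not in print is `IRConjecture3`
(label of record R196: a dictionary, not a reduction; `BalabanUV3 mk` is logically idle). [cite: Balaban1985UV3, Thm 1 p.257; Thm 2 p.272] -/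
theorem massGap3Cofinal_su2_W_oneHalf_of_irConjecture3 {L : ℕ} {mk : Construction L} {eps0 : ℝ → ℝ}
    (hfam : Nonempty (Family L eps0)) {κ_b C_b κ : ℝ} (hκb : 1 / 100 ≤ κ_b) (hC : 0 < C_b) (hκ : 0 < κ) (hUV : BalabanUV3 mk)
    (hIR : IRConjecture3 (ballOfRobustBall 2 κ_b (4 / 125) (2 / 125) (1 / 4)) suFrobDist (fundamentalRep (Fin 2))
      (balabanCouplings L (suGroupModel 2) eps0) C_b κ) :
    MassGap3Cofinal (balabanCouplings L (suGroupModel 2) eps0) suFrobDist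
      (fundamentalRep (Fin 2) : RobustBall.SUN 2 →* Matrix (Fin 2) (Fin 2) ℂ) :=
  massGap3Cofinal_suN_balaban_of_irConjecture3 hfam hC hκ (by norm_num : (0 : ℝ) < 1 / 100) hUV
    (RobustBall.su2_clusterDomainClusteringW_dim3_star_oneHalf_t100 κ_b hκb).1 hIR

/-- **The COVARIANT §Y4 sentence on the tier-2 ball at Wilson `β_W = 1/2`, Y2's input HYPOTHESIS-FREE (PROVED bookkeeping; the shape of
`CovariantFamily.massGap3Cofinal_su2_W_of_irConjecture3Cov`, ceiling `1/8 ↦ 1/2`).**  LABEL OF RECORD for `IRConjecture3Cov` (R196,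
verbatim): «⟹ target PROVED; converse NOT KNOWN; a genuine sufficient condition, possibly strictly stronger, never "the remaining gap"».
[cite: Balaban1985Averaging, (11), (15) p.19] -/
theorem massGap3Cofinal_su2_W_oneHalf_of_irConjecture3Cov {L : ℕ} {mk : Construction L} {eps0 : ℝ → ℝ}
    (hfam : Nonempty (Family L eps0)) {κ_b C_b κ : ℝ} (hκb : 1 / 100 ≤ κ_b) (hC : 0 < C_b) (hκ : 0 < κ) (hUV : BalabanUV3 mk)
    (hIR : IRConjecture3Cov (ballOfRobustBall 2 κ_b (4 / 125) (2 / 125) (1 / 4)) suFrobDist (fundamentalRep (Fin 2))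
      (balabanCouplings L (suGroupModel 2) eps0) C_b κ) :
    MassGap3Cofinal (balabanCouplings L (suGroupModel 2) eps0) suFrobDist
      (fundamentalRep (Fin 2) : RobustBall.SUN 2 →* Matrix (Fin 2) (Fin 2) ℂ) :=
  massGap3Cofinal_su2_W_oneHalf_of_irConjecture3 hfam hκb hC hκ hUV (irConjecture3_of_cov hIR)

/-- **The same, PRINT-FREE (theory-2's F2 shape: `BalabanUV3 mk` and `mk` deleted; PROVED bookkeeping).**  What remains of print is the
index set `balabanCouplings` and its unboundedness — the kernel record that `BalabanUV3` is evidential in these sentences.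
[cite: Balaban1985UV3, p.256 L15–18] -/
theorem massGap3Cofinal_su2_W_oneHalf_of_irConjecture3Cov_printFree {L : ℕ} {eps0 : ℝ → ℝ} (hfam : Nonempty (Family L eps0))
    {κ_b C_b κ : ℝ} (hκb : 1 / 100 ≤ κ_b) (hC : 0 < C_b) (hκ : 0 < κ)
    (hIR : IRConjecture3Cov (ballOfRobustBall 2 κ_b (4 / 125) (2 / 125) (1 / 4)) suFrobDist (fundamentalRep (Fin 2))
      (balabanCouplings L (suGroupModel 2) eps0) C_b κ) :
    MassGap3Cofinal (balabanCouplings L (suGroupModel 2) eps0) suFrobDist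
      (fundamentalRep (Fin 2) : RobustBall.SUN 2 →* Matrix (Fin 2) (Fin 2) ℂ) :=
  massGap3Cofinal_of_irConjecture3_printFree (not_bddAbove_balabanCouplings (suGroupModel 2) hfam) hC hκ
    (by norm_num : (0 : ℝ) < 1 / 100) (suFrobDist_bddAbove 2)
    (RobustBall.su2_clusterDomainClusteringW_dim3_star_oneHalf_t100 κ_b hκb).1 (irConjecture3_of_cov hIR)

/-- **In PRINT'S quantifier order on the tier-2 ball at `β_W = 1/2` (PROVED bookkeeping):** `∃ eps0` first (print, p. 256 L15–18), then for
every ball parameter `κ_b ≥ 1/100` and every `C_b`, `κ`: `Nonempty (Family L eps0) → IRConjecture3` on the row's ball (label of record R196: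
a dictionary, not a reduction) `⟹ MassGap3Cofinal`. [cite: Balaban1985UV3, p.256 L15–18; Thm 2 p.272] -/
theorem massGap3Cofinal_su2_W_oneHalf_printedOrder_of_irConjecture3 {L : ℕ} (mk : Construction L) (hUV : BalabanUV3 mk) :
    ∃ eps0 : ℝ → ℝ, (∀ g : ℝ, 0 < g → 0 < eps0 g) ∧
      (∀ S : Family L eps0, ∀ k, k ≤ S.1.K → (mk (RobustBall.SUN 2) (suGroupModel 2) S.1).ineq41_47 k) ∧
      ∀ (κ_b C_b κ : ℝ), 1 / 100 ≤ κ_b → 0 < C_b → 0 < κ → Nonempty (Family L eps0) →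
        IRConjecture3 (ballOfRobustBall 2 κ_b (4 / 125) (2 / 125) (1 / 4)) suFrobDist (fundamentalRep (Fin 2))
          (balabanCouplings L (suGroupModel 2) eps0) C_b κ →
          MassGap3Cofinal (balabanCouplings L (suGroupModel 2) eps0) suFrobDist
            (fundamentalRep (Fin 2) : RobustBall.SUN 2 →* Matrix (Fin 2) (Fin 2) ℂ) := by
  obtain ⟨eps0, hpos, h2, h⟩ := massGap3Cofinal_suN_balaban_printedOrder_of_irConjecture3 (N := 2) mk hUV
  refine ⟨eps0, hpos, h2, fun κ_b C_b κ hκb hC hκ hfam hIR => ?_⟩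
  exact h (ballOfRobustBall 2 κ_b (4 / 125) (2 / 125) (1 / 4)) C_b κ (1 / 100) hC hκ (by norm_num) hfam
    (RobustBall.su2_clusterDomainClusteringW_dim3_star_oneHalf_t100 κ_b hκb).1 hIR

/-- **The conjecture's counted task on the `SU(2)` tier-2 `β_W = 1/2` row (PROVED arithmetic): still at least ONE block-RG step beyond
Bałaban's `K` at `O(1)` effective coupling (`M' ≠ 0`), for every admissible `γ₀`, at the row's ball for the record (ball parameter
`κ_b = 1/100`).** [cite: Balaban1985UV3, (5) p.256] -/
theorem su2_row_W_oneHalf_crossover_pos {L : ℕ} (S : Scales L) (M' : ℕ)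
    (h : betaTree (suGroupModel 2) S / (L : ℝ) ^ (S.K + M') ≤ (ballOfRobustBall 2 (1 / 100) (4 / 125) (2 / 125) (1 / 4)).βstar) :
    M' ≠ 0 := by
  have h2 : (2 : ℝ) ≤ (L : ℝ) ^ M' := su2_two_le_pow_of_betaTree_div_pow_le_quarter S M' h
  rintro rfl
  norm_num at h2

/-! ## §2  Wilson `β_W = 9/20` on the weighted ball at the lineage rate `log (6/5)` (the rate of `CovariantFamily`'s tier-2 sentence) -/

/-- **The COVARIANT §Y4 sentence on the tier-2 ball `ClusterDomain (log 6/5) (7/250) (7/500)` at Wilson `β_W = 9/20`, rate `log (6/5)`,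
Y2's input HYPOTHESIS-FREE (PROVED bookkeeping):** ds-2's row `RobustBall.su2_clusterDomainClusteringW_dim3_star_nineTwentieths_w65` BY
NAME — same ball parameter and rate as `CovariantFamily.massGap3Cofinal_su2_W_of_irConjecture3Cov` (ceiling there `β_W = 1/8`).  LABEL OF
RECORD for `IRConjecture3Cov` (R196, verbatim) as in §1. [cite: Balaban1985Averaging, (11), (15) p.19] -/
theorem massGap3Cofinal_su2_W_nineTwentieths_of_irConjecture3Cov {L : ℕ} {mk : Construction L} {eps0 : ℝ → ℝ}
    (hfam : Nonempty (Family L eps0)) {C_b κ : ℝ} (hC : 0 < C_b) (hκ : 0 < κ) (hUV : BalabanUV3 mk)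
    (hIR : IRConjecture3Cov (ballOfRobustBall 2 (Real.log (6 / 5)) (7 / 250) (7 / 500) (9 / 40)) suFrobDist (fundamentalRep (Fin 2))
      (balabanCouplings L (suGroupModel 2) eps0) C_b κ) :
    MassGap3Cofinal (balabanCouplings L (suGroupModel 2) eps0) suFrobDist
      (fundamentalRep (Fin 2) : RobustBall.SUN 2 →* Matrix (Fin 2) (Fin 2) ℂ) :=
  massGap3Cofinal_suN_balaban_of_irConjecture3 hfam hC hκ RobustBall.log_sixFifths_pos_and_log_threeHalves_pos.1 hUV
    RobustBall.su2_clusterDomainClusteringW_dim3_star_nineTwentieths_w65.1 (irConjecture3_of_cov hIR)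

end Summit.Ventures.YMGap.YM3IR

end
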